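import Mathlib
import HarnessLib.Audit
import Summits.PneNP.PneNP.Theorems.PstarChordBridgeMultipartite
import Summits.PneNP.PneNP.Theorems.PstarChordBridgeFlat

/-!
# Bundles are killable: pairwise killability of the chords of a core is a theorem (ROUND-24, memo §9 R4/G2′; residue (c1))

FRONTIER range-avoidance ladder, rung F-N3, ROUND 24 (cell `pnp-ideate`, planner memo `r24/CORE-BOUND-NOTES.md` §7 G2′ ("HENCE ANY TWO CHORDS
OF A CORE ARE SIMULTANEOUSLY KILLABLE SOMEWHERE"), §9 R4; restricted-model proof complexity — nothing here bears on `P` versus `NP`).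

`PstarChordBridgeCollapse.killable_pair_or_exc` (R4) left one exception: two chords `e ≠ e'` of well-formed bridge data whose fundamental
AND-sums form an ELLIPTIC BUNDLE.  `PstarChordBridgeMultipartite.card_symmDiff_le_two_of_bundle` showed that then `S := D e ∆ D e'` has one
or two outputs, and `PstarChordBridgeBundle.bundle_adj` that its AND-graph is complete multipartite — so `S` is a single output `(p,q)` or a
`σ`-pair `(σ,b), (σ,b')` (`exists_common_of_bundle`: two disjoint adjacent pairs with no cross adjacency have no labelling in `𝔽₂²`).
This file closes the exception:

* `killable_of_bundle` — **bundled chords are killable at a common base point.**  If not, then on the set `{Q_S = γ_e + γ_{e'}}` both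
  `Q_{D e} ≡ γ_e + 1` and `Q_{D e'} ≡ γ_{e'} + 1`; that set contains the coordinate hyperplane `{x_p = 0}` (resp. `{x_σ = 0}`) when
  `γ_e + γ_{e'} = 0`, and is the flat `{x_p = x_q = 1}` resp. `{x_σ = 1, x_b + x_{b'} = 1}` when `γ_e + γ_{e'} = 1` — and a fundamental
  AND-sum is constant on none of these (`PstarChordBridgeFlat`);
* `killable_pair` — **R4 unconditionally**: any two distinct chords of well-formed bridge data (pure `(r,3/2)`-expanding instance with simple
  overlaps, `#J₀ ≤ r`) are killable at a common base point;
* `direction_collapse`, `regime_cases` — `PstarChordBridgeCollapse.direction_collapse_sys` without its bundle-freeness hypothesis and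
  `PstarChordBridgeBasis.regime_cases` without its pairwise-killability hypothesis `hK`.

So the calibration core CONS-P3 (whose two chords ARE a killable bundle) was the general case, and the regime theorem of the `CoreShape` chain
now has exactly the hypotheses: well-formed liftable bridge data on a pure typed expanding core, privates unread, (T3), (M0).
-/

set_option linter.dupNamespace false -- `Summit.PneNP.PneNP.…`: summit = sub-problem name (D-0017 single-conjunct layout)

open Finset Module Literature.Computability.Complexity
open scoped symmDiff
open Summit.PneNP.PneNP.Theorems.PstarTyped (Typed)
open Summit.PneNP.PneNP.Theorems.PstarSALevel (varSet bdry BoundaryExpanding SimpleOverlap)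
open Summit.PneNP.PneNP.Theorems.PstarCubeIdeals (IsAffineFn)
open Summit.PneNP.PneNP.Theorems.PstarRankRigidityTwo (linPart)
open Summit.PneNP.PneNP.Theorems.PstarProductRank (qform polar)
open Summit.PneNP.PneNP.Theorems.PstarPathRank (AndAdj and_ne andPair_ne)
open Summit.PneNP.PneNP.Theorems.PstarReadSumset (V2)
open Summit.PneNP.PneNP.Theorems.PstarGraphQuadGapTwoForms (sum_symmDiff_zmod2)
open Summit.PneNP.PneNP.Theorems.PstarChordBridgeTools
open Summit.PneNP.PneNP.Theorems.PstarChordBridge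
open Summit.PneNP.PneNP.Theorems.PstarChordBridgeForcing
open Summit.PneNP.PneNP.Theorems.PstarChordBridgeCollapse (Bundle killable_pair_or_exc)
open Summit.PneNP.PneNP.Theorems.PstarChordBridgeBasis
open Summit.PneNP.PneNP.Theorems.PstarChordBridgeBundle (bundle_adj symmDiff_nonempty_of_ne)
open Summit.PneNP.PneNP.Theorems.PstarChordBridgeMultipartite (card_symmDiff_le_two_of_bundle)
open Summit.PneNP.PneNP.Theorems.PstarChordBridgeFlat (false_of_const_on_hyperplane false_of_const_on_pair_flat false_of_const_on_sigma_flat)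

namespace Summit.PneNP.PneNP.Theorems.PstarChordBridgeKill

variable {n m : ℕ}

/-! ## The shape of a bundle's symmetric difference -/

/-- AND-adjacency in a two-element family. -/
private theorem andAdj_pair {I : LocalMap 4 n m} {j k : Fin m} {c d : Fin n} (h : AndAdj I ({j, k} : Finset (Fin m)) c d) :
    ((I.vars j 2 = c ∧ I.vars j 3 = d) ∨ (I.vars j 2 = d ∧ I.vars j 3 = c)) ∨
    ((I.vars k 2 = c ∧ I.vars k 3 = d) ∨ (I.vars k 2 = d ∧ I.vars k 3 = c)) := by
  obtain ⟨i, hi, h⟩ := h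
  rcases mem_insert.1 hi with rfl | hi
  · exact Or.inl h
  · rw [mem_singleton] at hi
    subst hi
    exact Or.inr h

/-- **A two-output bundle difference is a `σ`-pair.**  If `e, e'` form a bundle and `D e ∆ D e' = {j, k}` with `j ≠ k`, then `j` and `k` share
exactly one AND variable `σ` (their other variables `b ≠ b'`): with the labels of `bundle_adj`, two disjoint adjacent pairs with no cross
adjacency do not exist in `𝔽₂²`. -/
theorem exists_common_of_bundle (I : LocalMap 4 n m) (hI : I.IsPure xorAndPred) (hS : SimpleOverlap I) (B : BridgeData n m) {e e' : Fin m}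
    (hb : Bundle I B e e') {j k : Fin m} (hjk : j ≠ k) (hS2 : B.D e ∆ B.D e' = {j, k}) :
    ∃ σ b b' : Fin n, σ ≠ b ∧ σ ≠ b' ∧ b ≠ b' ∧
      ((I.vars j 2 = σ ∧ I.vars j 3 = b) ∨ (I.vars j 2 = b ∧ I.vars j 3 = σ)) ∧
      ((I.vars k 2 = σ ∧ I.vars k 3 = b') ∨ (I.vars k 2 = b' ∧ I.vars k 3 = σ)) := by
  classical
  have hj23 := and_ne I hI j
  have hk23 := and_ne I hI k
  have hpairs := andPair_ne I hI hS hjk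
  by_cases h1 : I.vars j 2 = I.vars k 2
  · exact ⟨I.vars k 2, I.vars j 3, I.vars k 3, h1 ▸ hj23, hk23, fun h => hpairs (Or.inl ⟨h1, h⟩), Or.inl ⟨h1, rfl⟩, Or.inl ⟨rfl, rfl⟩⟩
  by_cases h2 : I.vars j 2 = I.vars k 3
  · exact ⟨I.vars k 3, I.vars j 3, I.vars k 2, h2 ▸ hj23, hk23.symm, fun h => hpairs (Or.inr ⟨h2, h⟩), Or.inl ⟨h2, rfl⟩, Or.inr ⟨rfl, rfl⟩⟩
  by_cases h3 : I.vars j 3 = I.vars k 2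
  · exact ⟨I.vars k 2, I.vars j 2, I.vars k 3, h3 ▸ hj23.symm, hk23, fun h => hpairs (Or.inr ⟨h, h3⟩), Or.inr ⟨rfl, h3⟩, Or.inl ⟨rfl, rfl⟩⟩
  by_cases h4 : I.vars j 3 = I.vars k 3
  · exact ⟨I.vars k 3, I.vars j 2, I.vars k 2, h4 ▸ hj23.symm, hk23.symm, fun h => hpairs (Or.inl ⟨h, h4⟩), Or.inr ⟨rfl, h4⟩,
      Or.inr ⟨rfl, rfl⟩⟩
  -- all four variables distinct: contradiction with the complete multipartite labelling
  exfalso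
  obtain ⟨ν₁, ν₂, hν₁, hν₂, κ, hbκ⟩ := hb
  have hadj := bundle_adj I hI hS B hν₁ hν₂ hbκ
  rw [hS2] at hadj
  have A := hadj (I.vars j 2) (I.vars j 3)
  rw [if_pos ⟨j, mem_insert_self _ _, Or.inl ⟨rfl, rfl⟩⟩] at A
  have A' := hadj (I.vars k 2) (I.vars k 3)
  rw [if_pos ⟨k, mem_insert_of_mem (mem_singleton_self _), Or.inl ⟨rfl, rfl⟩⟩] at A'
  have C1 := hadj (I.vars j 2) (I.vars k 2)
  rw [if_neg (fun h => by
    rcases andAdj_pair h with (⟨-, b⟩ | ⟨a, -⟩) | (⟨a, -⟩ | ⟨-, b⟩)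
    exacts [h3 b, h1 a, h1 a.symm, h2 b.symm])] at C1
  have C2 := hadj (I.vars j 2) (I.vars k 3)
  rw [if_neg (fun h => by
    rcases andAdj_pair h with (⟨-, b⟩ | ⟨a, -⟩) | (⟨a, -⟩ | ⟨-, b⟩)
    exacts [h4 b, h2 a, h1 a.symm, h2 b.symm])] at C2
  have C3 := hadj (I.vars j 3) (I.vars k 2)
  rw [if_neg (fun h => by
    rcases andAdj_pair h with (⟨a, -⟩ | ⟨a, -⟩) | (⟨a, -⟩ | ⟨-, b⟩)
    exacts [hj23 a, h1 a, h3 a.symm, h4 b.symm])] at C3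
  have C4 := hadj (I.vars j 3) (I.vars k 3)
  rw [if_neg (fun h => by
    rcases andAdj_pair h with (⟨a, -⟩ | ⟨a, -⟩) | (⟨a, -⟩ | ⟨a, -⟩)
    exacts [hj23 a, h2 a, h3 a.symm, hk23 a])] at C4
  revert A A' C1 C2 C3 C4
  generalize linPart hν₁ (Pi.single (I.vars j 2) 1) = a₁
  generalize linPart hν₂ (Pi.single (I.vars j 2) 1) = a₂
  generalize linPart hν₁ (Pi.single (I.vars j 3) 1) = b₁
  generalize linPart hν₂ (Pi.single (I.vars j 3) 1) = b₂
  generalize linPart hν₁ (Pi.single (I.vars k 2) 1) = c₁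
  generalize linPart hν₂ (Pi.single (I.vars k 2) 1) = c₂
  generalize linPart hν₁ (Pi.single (I.vars k 3) 1) = d₁
  generalize linPart hν₂ (Pi.single (I.vars k 3) 1) = d₂
  revert a₁ a₂ b₁ b₂ c₁ c₂ d₁ d₂
  decide

/-! ## Bundles are killable -/

/-- Over `𝔽₂` the AND-sum of a symmetric difference is the sum of the AND-sums. -/
theorem qform_symmDiff (I : LocalMap 4 n m) (A C : Finset (Fin m)) (x : Fin n → ZMod 2) :
    qform (A ∆ C) (fun j => I.vars j 2) (fun j => I.vars j 3) x =
      qform A (fun j => I.vars j 2) (fun j => I.vars j 3) x + qform C (fun j => I.vars j 2) (fun j => I.vars j 3) x := by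
  simp only [qform]
  exact sum_symmDiff_zmod2 A C _

/-- **Bundled chords are killable at a common base point.**  On a pure `(r,3/2)`-expanding instance with simple overlaps, two distinct chords
`e ≠ e'` of well-formed bridge data with `#J₀ ≤ r` that form an elliptic bundle have a common zero of `u_e, u_{e'}`.  See the module
docstring for the proof. -/
theorem killable_of_bundle (I : LocalMap 4 n m) (hI : I.IsPure xorAndPred) (hS : SimpleOverlap I) {r : ℕ} (hB : BoundaryExpanding r I)
    {B : BridgeData n m} (hW : B.WF I) (hr : B.J₀.card ≤ r) {e e' : Fin m} (he : e ∈ B.N) (he' : e' ∈ B.N) (hne : e ≠ e')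
    (hb : Bundle I B e e') : ∃ a, (sys I B).u e a = 0 ∧ (sys I B).u e' a = 0 := by
  classical
  by_contra hnot
  push Not at hnot
  -- fundamental-set facts
  have heD : e ∉ B.D e := fun h => (mem_sdiff.1 (hW.hD e he h)).2 he
  have heD' : e' ∉ B.D e' := fun h => (mem_sdiff.1 (hW.hD e' he' h)).2 he'
  have hDr : (B.D e).card ≤ r := (card_le_card ((hW.hD e he).trans sdiff_subset)).trans hr
  have hDr' : (B.D e').card ≤ r := (card_le_card ((hW.hD e' he').trans sdiff_subset)).trans hr
  -- on `{Q_S = γ + γ'}` both AND-sums are frozen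
  have key : ∀ a, qform (B.D e ∆ B.D e') (fun j => I.vars j 2) (fun j => I.vars j 3) a = gam B e + gam B e' →
      qform (B.D e) (fun j => I.vars j 2) (fun j => I.vars j 3) a = gam B e + 1 ∧
      qform (B.D e') (fun j => I.vars j 2) (fun j => I.vars j 3) a = gam B e' + 1 := by
    intro a ha
    rw [qform_symmDiff] at ha
    have h := hnot a
    rw [sys_u_eq, sys_u_eq] at h
    have fin : ∀ q q' g g' : ZMod 2, q + q' = g + g' → (g + q = 0 → g' + q' ≠ 0) → q = g + 1 ∧ q' = g' + 1 := by decide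
    exact fin _ _ _ _ ha h
  have fin1 : ∀ t : ZMod 2, t ≠ 0 → t = 1 := by decide
  -- `S` has one or two outputs
  have hS2 := card_symmDiff_le_two_of_bundle I hI hS hB hW hr he he' hb
  have hS0 := (symmDiff_nonempty_of_ne I hI hS hW he he' hne).card_pos
  rcases Nat.lt_or_ge (B.D e ∆ B.D e').card 2 with hlt | hge
  · -- `S = {j}`, `Q_S = x_p x_q`
    obtain ⟨j, hj⟩ := card_eq_one.1 (show (B.D e ∆ B.D e').card = 1 by omega)
    have hR : ∀ a : Fin n → ZMod 2, qform (B.D e ∆ B.D e') (fun j => I.vars j 2) (fun j => I.vars j 3) a =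
        a (I.vars j 2) * a (I.vars j 3) := fun a => by rw [hj]; simp [qform]
    by_cases hδ : gam B e + gam B e' = 0
    · exact false_of_const_on_hyperplane I hI hS heD (hW.hDeven e he) (p := I.vars j 2) (c := gam B e + 1)
        fun x hx => (key x (by rw [hR, hx, zero_mul, hδ])).1
    · exact false_of_const_on_pair_flat I hI hS hB hDr heD (hW.hDeven e he) (and_ne I hI j) (c := gam B e + 1)
        fun x hp hq => (key x (by rw [hR, hp, hq, one_mul, fin1 _ hδ])).1
  · -- `S = {j, k}`, a `σ`-pair, `Q_S = x_σ (x_b + x_{b'})`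
    obtain ⟨j, k, hjk, hjk'⟩ := card_eq_two.1 (show (B.D e ∆ B.D e').card = 2 by omega)
    obtain ⟨σ, b, b', hσb, hσb', hbb', hjv, hkv⟩ := exists_common_of_bundle I hI hS B hb hjk hjk'
    have hR : ∀ a : Fin n → ZMod 2, qform (B.D e ∆ B.D e') (fun j => I.vars j 2) (fun j => I.vars j 3) a = a σ * (a b + a b') := by
      intro a
      rw [hjk']
      simp only [qform, sum_pair hjk]
      rcases hjv with ⟨h2, h3⟩ | ⟨h2, h3⟩ <;> rcases hkv with ⟨g2, g3⟩ | ⟨g2, g3⟩ <;> rw [h2, h3, g2, g3] <;> ring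
    by_cases hδ : gam B e + gam B e' = 0
    · exact false_of_const_on_hyperplane I hI hS heD (hW.hDeven e he) (p := σ) (c := gam B e + 1)
        fun x hx => (key x (by rw [hR, hx, zero_mul, hδ])).1
    · have hδ1 := fin1 _ hδ
      have hmem : j ∈ B.D e ∆ B.D e' := by rw [hjk']; exact mem_insert_self _ _
      rcases mem_symmDiff.1 hmem with ⟨hjD, -⟩ | ⟨hjD', -⟩
      · exact false_of_const_on_sigma_flat I hI hS hB hDr heD (hW.hDeven e he) hσb hσb' hbb' ⟨j, hjD, hjv⟩ (c := gam B e + 1)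
          fun x hσ hbx => (key x (by rw [hR, hσ, hbx, one_mul, hδ1])).1
      · exact false_of_const_on_sigma_flat I hI hS hB hDr' heD' (hW.hDeven e' he') hσb hσb' hbb' ⟨j, hjD', hjv⟩ (c := gam B e' + 1)
          fun x hσ hbx => (key x (by rw [hR, hσ, hbx, one_mul, hδ1])).2

/-- **R4 — pairwise killability, unconditionally.**  On a pure `(r,3/2)`-expanding instance with simple overlaps, any two distinct chords of
well-formed bridge data with `#J₀ ≤ r` are killable at a common base point (`u_e(a) = u_{e'}(a) = 0`). -/
theorem killable_pair (I : LocalMap 4 n m) (hI : I.IsPure xorAndPred) (hS : SimpleOverlap I) {r : ℕ} (hB : BoundaryExpanding r I)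
    {B : BridgeData n m} (hW : B.WF I) (hr : B.J₀.card ≤ r) :
    ∀ e ∈ B.N, ∀ e' ∈ B.N, e ≠ e' → ∃ a, (sys I B).u e a = 0 ∧ (sys I B).u e' a = 0 := fun e he e' he' hne => by
  rcases killable_pair_or_exc I hI hS hB hW hr he he' hne with h | h
  · exact h
  · exact killable_of_bundle I hI hS hB hW hr he he' hne h

/-- **R5 — direction collapse for a core**, without the bundle-freeness hypothesis of `PstarChordBridgeCollapse.direction_collapse_sys`:
infeasible model and no pendant reading a private ⇒ (U1) one line `{0, m}` contains every read vector, or (U2) exactly one chord is read, with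
two independent read vectors. -/
theorem direction_collapse (I : LocalMap 4 n m) (hI : I.IsPure xorAndPred) (hS : SimpleOverlap I) {r : ℕ} (hB : BoundaryExpanding r I)
    {B : BridgeData n m} (hW : B.WF I) (hr : B.J₀.card ≤ r)
    (hun : ∀ v ∈ privs I B.N, (∀ g ∈ B.G₁, I.vars g 2 ≠ v ∧ I.vars g 3 ≠ v) ∧ ∀ g ∈ B.G₂, I.vars g 2 ≠ v ∧ I.vars g 3 ≠ v)
    (hinf : (sys I B).Infeasible B.N) :
    (∃ mv : V2, ∀ e ∈ B.N, ((sys I B).ρ e 0 = 0 ∨ (sys I B).ρ e 0 = mv) ∧ ((sys I B).ρ' e 0 = 0 ∨ (sys I B).ρ' e 0 = mv)) ∨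
    (∃ e₀ ∈ B.N, (sys I B).ρ e₀ 0 ≠ 0 ∧ (sys I B).ρ' e₀ 0 ≠ 0 ∧ (sys I B).ρ e₀ 0 ≠ (sys I B).ρ' e₀ 0 ∧
      ∀ e ∈ B.N, e ≠ e₀ → (sys I B).ρ e 0 = 0 ∧ (sys I B).ρ' e 0 = 0) := by
  have hconst := const_of_unread I B hun
  exact (sys I B).direction_collapse hinf (r := fun e => (sys I B).ρ e 0) (r' := fun e => (sys I B).ρ' e 0)
    (fun e a => (hconst e a 0).1) (fun e a => (hconst e a 0).2) (killable_pair I hI hS hB hW hr)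

/-- **The regime theorem for a terminal core** — `PstarChordBridgeBasis.regime_cases` with pairwise killability DISCHARGED (`killable_pair`).
Pure typed `(r,3/2)`-expanding instance with simple overlaps, well-formed bridge data with `#J₀ ≤ r` and the lift property, no pendant reading
a private, the terminal system unsolvable but solvable after deleting any single chord.  Then EITHER (U2) `N = {e₀}` is a single chord read by
both constraints independently, OR there is a direction `m ≠ 0` carrying every read vector such that every chord of `N` is (EQ), (EXC) or
(NOR) with respect to `q_m`. -/
theorem regime_cases (I : LocalMap 4 n m) (hI : I.IsPure xorAndPred) (hT : Typed I) (hS : SimpleOverlap I) {r : ℕ}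
    (hB : BoundaryExpanding r I) {B : BridgeData n m} (hW : B.WF I) (hr : B.J₀.card ≤ r) (hL : Lift I B)
    (hun : ∀ v ∈ privs I B.N, (∀ g ∈ B.G₁, I.vars g 2 ≠ v ∧ I.vars g 3 ≠ v) ∧ ∀ g ∈ B.G₂, I.vars g 2 ≠ v ∧ I.vars g 3 ≠ v)
    (hT3 : ¬ ∃ z, Solution I B B.J₀ z) (hM0 : ∀ e ∈ B.N, ∃ z, Solution I B (B.J₀.erase e) z) :
    (∃ e₀, B.N = {e₀} ∧ (sys I B).ρ e₀ 0 ≠ 0 ∧ (sys I B).ρ' e₀ 0 ≠ 0 ∧ (sys I B).ρ e₀ 0 ≠ (sys I B).ρ' e₀ 0) ∨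
    (∃ mv : V2, mv ≠ 0 ∧ (∀ e ∈ B.N, ((sys I B).ρ e 0 = 0 ∨ (sys I B).ρ e 0 = mv) ∧ ((sys I B).ρ' e 0 = 0 ∨ (sys I B).ρ' e 0 = mv)) ∧
      ∀ e ∈ B.N,
        (∃ κ : ZMod 2, ∀ x, qform (B.D e) (fun j => I.vars j 2) (fun j => I.vars j 3) x = qDir I B mv x + κ) ∨
        (∃ ν₁ ν₂ : (Fin n → ZMod 2) → ZMod 2, IsAffineFn ν₁ ∧ IsAffineFn ν₂ ∧ ∃ κ : ZMod 2, ∀ x,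
          qform (B.D e) (fun j => I.vars j 2) (fun j => I.vars j 3) x = qDir I B mv x + ν₁ x * ν₂ x + κ) ∨
        (∃ a b : Fin n → ZMod 2, polarDir I B mv a b = 1 ∧
          (∀ x, qDir I B mv x =
            (polarDir I B mv x b + (qDir I B mv b + qDir I B mv 0)) * (polarDir I B mv x a + (qDir I B mv a + qDir I B mv 0)) + 1) ∧
          ∃ m₁ m₂ : (Fin n → ZMod 2) → ZMod 2, IsAffineFn m₁ ∧ IsAffineFn m₂ ∧
            ∀ x, qform (B.D e) (fun j => I.vars j 2) (fun j => I.vars j 3) x + (gam B e + 1) =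
              (polarDir I B mv x b + (qDir I B mv b + qDir I B mv 0) + 1) * m₁ x +
              (polarDir I B mv x a + (qDir I B mv a + qDir I B mv 0) + 1) * m₂ x)) :=
  PstarChordBridgeBasis.regime_cases I hI hT hS hB hW hr hL hun (killable_pair I hI hS hB hW hr) hT3 hM0

end Summit.PneNP.PneNP.Theorems.PstarChordBridgeKill
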